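import Summits.QuantumAdvantage.AdviceFreeQNC0.GenuineProductBound
import Summits.QuantumAdvantage.AdviceFreeQNC0.PLDAMSAllDensities
import Summits.QuantumAdvantage.AdviceFreeQNC0.EliminationHardness
import HarnessLib

/-!
# Cell qa-qnc0 (rung F-Q1, route RingFrame, crux α): "Theorem V" — the walk game (every charge) and
# the ring game are hard up to degree `c·log₂ n / log₂ log₂ n` (planner qa-qnc0-p1 ROUND-9 §6b, T7, P10)

UNCONDITIONAL rung on crux α (`RingToElim` ⟺ `RingHard 2`, stmt-QuantumAdvantage-19119), one rung
ABOVE Theorem U (`walkHard_sqrtLog` / `ringHard_sqrtLogDeg`, degree `c√(log n)`, p444026): planner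
qa-qnc0-p1 gen 10's THEOREM-TARGET T7 (`Sketch10.lean` §22.3, statements VERBATIM):

* `walkHard_logOverLogLog : WalkHardLogOverLogLog` — `∃ θ < 1, c > 0, n₀: ∀ n ≥ n₀, ∀ D` with
  `D·(log₂ D + 1) ≤ c·log₂ n`, every charge `cc` and every walk strategy of degree `≤ D` on `n` bits
  wins on `≤ θ·2ⁿ` inputs;
* `ringHard_logOverLogLog : RingHardLogOverLogLog` (charge `n + 2` = the ring game in walk form).

Proof: cut `n = L + L'` with Bob's block AS SHORT AS ELIMINATION HARDNESS ALLOWS,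
`L' = n_E + K·D²` (`K ≥ 1/c₀²`, so `D ≤ c₀√L'` and `elimSqrtDec` gives the minimum fail weight
`η₀·2^{L'}`); the three genuine rows are constant on the atoms of the induced strategy
(`GenuineProductBound.lean`), of degree `≤ D(L'+1)#Ball(L',D) ≤ (M(D+1)²)^{D+2}`, `M = n_E + K + 1`,
which is `≤ n^{1/4} ≤ c_P√L` exactly when `D·log D ≲ log n` (`atomDeg_pow_four_le`); PLDAMS
(`pldams_allDensities`) at that degree; `card_ringWinU_le_of_budget`.  CEILING of the method: the
atom degree `D^{Θ(D)}` must stay below `√n`, so `log n / log log n` is where restriction to atoms of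
the induced strategy stops.  WHAT THIS IS NOT: nothing at polylog degree (`RingHard 2`), not the aside
`RingHardLogDeg` (½·log₂ n); constants absolute but astronomically small; no separation claim.
-/

noncomputable section

namespace Summit.QuantumAdvantage.AdviceFreeQNC0

open Finset
open Literature.Computability.MetaComplexity Literature.Computability.MetaComplexity.Smolensky

/-! ### Statements (verbatim from `Sketch10` §22.3) -/

/-- **THEOREM-TARGET T7 — "Theorem V"**: the walk game at every charge is hard up to degree
`c·log₂ n / log₂ log₂ n` (stated as `D·(log₂ D + 1) ≤ c·log₂ n`), `θ < 1` absolute. -/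
def WalkHardLogOverLogLog : Prop :=
  ∃ θ : ℝ, θ < 1 ∧ ∃ c : ℝ, 0 < c ∧ ∃ n₀ : ℕ, ∀ n ≥ n₀, ∀ D : ℕ,
    (D : ℝ) * (Nat.log 2 D + 1) ≤ c * Nat.log 2 n →
    ∀ cc : ℕ, ∀ y : Fin (n + 1) → (Fin n → Bool) → Bool, (∀ g, HasDeg (y g) D) →
      ((univ.filter fun u : Fin n → Bool => ringWinU cc y u = true).card : ℝ) ≤ θ * (2 : ℝ) ^ n

/-- corollary: the RING game (charge `n + 2`) up to degree `c·log₂ n / log₂ log₂ n`. -/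
def RingHardLogOverLogLog : Prop :=
  ∃ θ : ℝ, θ < 1 ∧ ∃ c : ℝ, 0 < c ∧ ∃ n₀ : ℕ, ∀ n ≥ n₀, ∀ D : ℕ,
    (D : ℝ) * (Nat.log 2 D + 1) ≤ c * Nat.log 2 n →
    ∀ y : Fin (n + 1) → (Fin n → Bool) → Bool, (∀ g, HasDeg (y g) D) →
      ((univ.filter fun u : Fin n → Bool => ringWinU (n + 2) y u = true).card : ℝ) ≤ θ * (2 : ℝ) ^ n

/-! ### Growth bookkeeping -/

/-- `#Ball(L', D) ≤ (L'+1)^D`. -/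
theorem card_ball_le (L' D : ℕ) : (ball L' D).card ≤ (L' + 1) ^ D := by
  classical
  have hsub : ball L' D ⊆ (Finset.range (D + 1)).biUnion
      fun j => Literature.Computability.MetaComplexity.Hegedus.layer L' j := by
    intro v hv
    unfold ball at hv
    rw [Finset.mem_filter] at hv
    exact Finset.mem_biUnion.2 ⟨wt v, Finset.mem_range.2 (by omega),
      Finset.mem_filter.2 ⟨Finset.mem_univ _, rfl⟩⟩
  refine (Finset.card_le_card hsub).trans (Finset.card_biUnion_le.trans ?_)
  rw [add_pow]
  refine Finset.sum_le_sum fun j hj => ?_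
  rw [Literature.Computability.MetaComplexity.Hegedus.card_layer, one_pow, mul_one]
  have h1 : L'.choose j ≤ L' ^ j := Nat.choose_le_pow L' j
  have h2 : 1 ≤ D.choose j := Nat.choose_pos (by have := Finset.mem_range.1 hj; omega)
  nlinarith

/-- The atom degree is at most `(L'+1)^{D+2}` once `D ≤ L' + 1`. -/
theorem atomDeg_le_pow {L' D : ℕ} (hD : D ≤ L' + 1) :
    D * ((L' + 1) * (ball L' D).card) ≤ (L' + 1) ^ (D + 2) := by
  calc D * ((L' + 1) * (ball L' D).card) ≤ (L' + 1) * ((L' + 1) * (L' + 1) ^ D) :=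
        Nat.mul_le_mul hD (Nat.mul_le_mul_left _ (card_ball_le L' D))
    _ = (L' + 1) ^ (D + 2) := by ring

/-- The exponent bookkeeping: `4(D+2)(m₀ + 2·log₂ D + 2) ≤ 12(m₀ + 4)·D·(log₂ D + 1)` for `D ≥ 1`. -/
theorem exponent_le {m₀ D t : ℕ} (hD : 1 ≤ D) :
    4 * ((D + 2) * (m₀ + 2 * t + 2)) ≤ 12 * (m₀ + 4) * (D * (t + 1)) := by
  have h1 : D + 2 ≤ 3 * D := by omega
  have h2 : m₀ + 2 * t + 2 ≤ (m₀ + 4) * (t + 1) := by nlinarith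
  calc 4 * ((D + 2) * (m₀ + 2 * t + 2)) ≤ 4 * ((3 * D) * ((m₀ + 4) * (t + 1))) :=
        Nat.mul_le_mul_left 4 (Nat.mul_le_mul h1 h2)
    _ = 12 * (m₀ + 4) * (D * (t + 1)) := by ring

/-- **The atom degree has fourth power `≤ n`** under the `log n / log log n` budget: with
`M < 2^{m₀}`, `L' + 1 ≤ M(D+1)²`, `1 ≤ D ≤ L'+1` and `12(m₀+4)·D·(log₂ D + 1) ≤ log₂ n`,
`(D(L'+1)#Ball)^4 ≤ n` and `2(L'+1) ≤ n`. -/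
theorem atomDeg_pow_four_le {M m₀ L' D n : ℕ} (hM : M < 2 ^ m₀) (hL' : L' + 1 ≤ M * (D + 1) ^ 2)
    (hD : 1 ≤ D) (hDL' : D ≤ L' + 1) (hbudget : 12 * (m₀ + 4) * (D * (Nat.log 2 D + 1)) ≤ Nat.log 2 n)
    (hn : n ≠ 0) :
    (D * ((L' + 1) * (ball L' D).card)) ^ 4 ≤ n ∧ 2 * (L' + 1) ≤ n := by
  set t := Nat.log 2 D with ht
  set e := m₀ + 2 * t + 2 with he
  -- `M (D+1)² ≤ 2^e`
  have hD1 : D + 1 ≤ 2 ^ (t + 1) := Nat.lt_pow_succ_log_self (by norm_num) D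
  have hbase : M * (D + 1) ^ 2 ≤ 2 ^ e := by
    calc M * (D + 1) ^ 2 ≤ 2 ^ m₀ * (2 ^ (t + 1)) ^ 2 := Nat.mul_le_mul hM.le (Nat.pow_le_pow_left hD1 2)
      _ = 2 ^ e := by rw [he, ← pow_mul, ← pow_add]; ring_nf
  have hexp : 4 * ((D + 2) * e) ≤ Nat.log 2 n := (exponent_le (m₀ := m₀) (t := t) hD).trans hbudget
  have hpow : 2 ^ (4 * ((D + 2) * e)) ≤ n := (Nat.pow_le_pow_right (by norm_num) hexp).trans
    (Nat.pow_log_le_self 2 hn)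
  constructor
  · calc (D * ((L' + 1) * (ball L' D).card)) ^ 4 ≤ ((L' + 1) ^ (D + 2)) ^ 4 :=
          Nat.pow_le_pow_left (atomDeg_le_pow hDL') 4
      _ ≤ ((2 ^ e) ^ (D + 2)) ^ 4 :=
          Nat.pow_le_pow_left (Nat.pow_le_pow_left (hL'.trans hbase) _) 4
      _ = 2 ^ (4 * ((D + 2) * e)) := by rw [← pow_mul, ← pow_mul]; ring_nf
      _ ≤ n := hpow
  · have he1 : 1 ≤ (D + 2) * e := by
      have : 1 ≤ e := by omega
      nlinarith
    calc 2 * (L' + 1) ≤ 2 * 2 ^ e := Nat.mul_le_mul_left 2 (hL'.trans hbase)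
      _ = 2 ^ (e + 1) := by rw [pow_succ]; ring
      _ ≤ 2 ^ (4 * ((D + 2) * e)) := Nat.pow_le_pow_right (by norm_num) (by nlinarith)
      _ ≤ n := hpow

/-- Fourth roots: for `L ≥ L₁(c)`, `d^4 ≤ 2L + 2` forces `d ≤ c·√L`. -/
theorem exists_sqrt_budget {c : ℝ} (hc : 0 < c) :
    ∃ L₁ : ℕ, ∀ L : ℕ, L₁ ≤ L → ∀ d : ℕ, d ^ 4 ≤ 2 * L + 2 → (d : ℝ) ≤ c * Real.sqrt L := by
  obtain ⟨L₁, hL₁⟩ := exists_nat_ge (4 / c ^ 4)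
  refine ⟨max L₁ 1, fun L hL d hd => ?_⟩
  have hL1 : (1 : ℝ) ≤ L := by exact_mod_cast le_trans (le_max_right _ _) hL
  have hLc : 4 / c ^ 4 ≤ (L : ℝ) := hL₁.trans (by exact_mod_cast le_trans (le_max_left _ _) hL)
  have hc4 : 0 < c ^ 4 := by positivity
  have h1 : (4 : ℝ) ≤ c ^ 4 * L := by rwa [div_le_iff₀ hc4, mul_comm] at hLc
  have hd' : ((d : ℝ)) ^ 4 ≤ 2 * L + 2 := by exact_mod_cast hd
  have h2 : ((d : ℝ)) ^ 4 ≤ (c * Real.sqrt L) ^ 4 := by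
    have hs : Real.sqrt L ^ 2 = (L : ℝ) := Real.sq_sqrt (by positivity)
    have e : (c * Real.sqrt L) ^ 4 = c ^ 4 * ((L : ℝ) * L) := by
      calc (c * Real.sqrt L) ^ 4 = c ^ 4 * (Real.sqrt L ^ 2) ^ 2 := by ring
        _ = c ^ 4 * ((L : ℝ) * L) := by rw [hs]; ring
    rw [e]
    nlinarith
  exact (pow_le_pow_iff_left₀ (by positivity) (by positivity) (by norm_num : (4 : ℕ) ≠ 0)).1 h2

/-! ### Theorem V -/

/-- **"Theorem V" (`WalkHardLogOverLogLog`, Sketch10 §22.3 verbatim): the walk game at every charge is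
hard up to degree `c·log₂ n / log₂ log₂ n`.** -/
theorem walkHard_logOverLogLog : WalkHardLogOverLogLog := by
  classical
  obtain ⟨κ, hκ, cP, hcP, nP, hP⟩ := pldams_allDensities
  obtain ⟨η₀, hη₀, c₀, hc₀, nE, hE⟩ := elimSqrtDec_of_lowDegAvoidMod3Sparse lowDegAvoidMod3Sparse
  -- `K ≥ 1/c₀²`
  obtain ⟨K, hK⟩ := exists_nat_ge (1 / c₀ ^ 2)
  set M := nE + K + 1 with hM
  set m₀ := Nat.log 2 M + 1 with hm₀
  have hMpow : M < 2 ^ m₀ := Nat.lt_pow_succ_log_self (by norm_num) M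
  obtain ⟨L₁, hL₁⟩ := exists_sqrt_budget hcP
  set c : ℝ := 1 / (12 * ((m₀ : ℝ) + 4)) with hc
  have hc_pos : 0 < c := by positivity
  refine ⟨1 - κ * η₀, by nlinarith [mul_pos hκ hη₀], c, hc_pos,
    2 * (nP + nE + L₁ + 1), fun n hn D hD cc y hy => ?_⟩
  have hn0 : n ≠ 0 := by omega
  -- the cut
  set L' := nE + K * D ^ 2 with hL'
  -- `2(L'+1) ≤ n` and the atom budget `dA^4 ≤ n` (trivial for `D = 0`)
  have hcut : 2 * (L' + 1) ≤ n ∧ (D * ((L' + 1) * (ball L' D).card)) ^ 4 ≤ 2 * (n - L') + 2 := by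
    rcases Nat.eq_zero_or_pos D with hD0 | hD1
    · subst hD0
      constructor
      · rw [hL']; omega
      · simp
    · have hbudgetR : 12 * ((m₀ : ℝ) + 4) * ((D : ℝ) * (Nat.log 2 D + 1)) ≤ (Nat.log 2 n : ℝ) := by
        have h := mul_le_mul_of_nonneg_left hD (by positivity : (0 : ℝ) ≤ 12 * ((m₀ : ℝ) + 4))
        rw [hc] at h
        have e : 12 * ((m₀ : ℝ) + 4) * (1 / (12 * ((m₀ : ℝ) + 4)) * (Nat.log 2 n : ℝ)) = Nat.log 2 n := by
          field_simp
        linarith [h, e.le, e.ge]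
      have hbudget : 12 * (m₀ + 4) * (D * (Nat.log 2 D + 1)) ≤ Nat.log 2 n := by exact_mod_cast hbudgetR
      have hL'M : L' + 1 ≤ M * (D + 1) ^ 2 := by rw [hL', hM]; nlinarith
      have hDL' : D ≤ L' + 1 := by
        rw [hL']
        have hK1 : 1 ≤ K := by
          have : (0 : ℝ) < 1 / c₀ ^ 2 := by positivity
          have : (0 : ℝ) < K := this.trans_le hK
          exact_mod_cast this
        nlinarith
      obtain ⟨h4, h2⟩ := atomDeg_pow_four_le hMpow hL'M hD1 hDL' hbudget hn0
      exact ⟨h2, h4.trans (by omega)⟩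
  obtain ⟨hL'n, hdA4⟩ := hcut
  -- split `n = L + L'`
  obtain ⟨L, hLdef, rfl⟩ : ∃ L : ℕ, L = n - L' ∧ n = L + L' := ⟨n - L', rfl, by omega⟩
  have hLn : L = L + L' - L' := by omega
  rw [← hLn] at hdA4
  have hLge : nP + nE + L₁ + 1 ≤ L := by omega
  -- Bob's minimum fail weight at length `L'`
  have hDc₀ : (D : ℝ) ≤ c₀ * Real.sqrt L' := by
    have hsq : ((D : ℝ)) ^ 2 ≤ (c₀ * Real.sqrt L') ^ 2 := by
      rw [mul_pow, Real.sq_sqrt (Nat.cast_nonneg _), hL']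
      push_cast
      have h1 : (1 : ℝ) ≤ c₀ ^ 2 * K := by
        have := mul_le_mul_of_nonneg_left hK (sq_nonneg c₀)
        rwa [mul_one_div, div_self (by positivity)] at this
      nlinarith [sq_nonneg (D : ℝ), mul_nonneg (sq_nonneg c₀) (Nat.cast_nonneg nE)]
    exact (pow_le_pow_iff_left₀ (by positivity) (by positivity) (by norm_num : (2 : ℕ) ≠ 0)).1 hsq
  have hw : η₀ * (2 : ℝ) ^ L' ≤ (distFail D (fun _ : Fin L' → Bool => false) : ℝ) :=
    le_distFail_zero_of fun a b ha hb dec => hE L' (by rw [hL']; omega) D hDc₀ a b ha hb dec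
  -- PLDAMS on Alice's cube at the atom degree
  have hdA : ((D * ((L' + 1) * (ball L' D).card) : ℕ) : ℝ) ≤ cP * Real.sqrt L :=
    hL₁ L (by omega) _ hdA4
  have hPL : ∀ g : CubeFn (ZMod 2) L, g ∈ lowDeg (ZMod 2) L (D * ((L' + 1) * (ball L' D).card)) →
      ∀ r : ℕ, κ * ((univ.filter fun u : Fin L → Bool => g u ≠ 0).card : ℝ) ≤
        ((univ.filter fun u : Fin L → Bool => g u ≠ 0 ∧ wt u % 3 = r % 3).card : ℝ) :=
    fun g hg r => hP L (by omega) r _ hdA g hg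
  exact card_ringWinU_le_of_budget hκ.le cc y hy hPL hw

/-- **The ring game (charge `n + 2`) is hard up to degree `c·log₂ n / log₂ log₂ n`.** -/
theorem ringHard_logOverLogLog : RingHardLogOverLogLog := by
  obtain ⟨θ, hθ, c, hc, n₀, h⟩ := walkHard_logOverLogLog
  exact ⟨θ, hθ, c, hc, n₀, fun n hn D hD y hy => h n hn D hD (n + 2) y hy⟩

end Summit.QuantumAdvantage.AdviceFreeQNC0

end
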